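import Mathlib
import Literature.Computability.AlgebraicComplexity.GlynnMultilinearSigmaPiSigma

/-!
# Row parts of graph monomials and the `2 × 2` block of a permutation — definitions for the stub
# `stub_levelBound` (crux `RankRigidMinimalRepr`, stmt-ValiantsHypothesis-18034, route `RigidityForcesSymmetry`,
# line `PairTiedTorusBound`)

Two small pieces of vocabulary used by the `2 × 2`-block double count that proves the registered stub
`stub_levelBound` («with one tied pair of columns every level-`s` typed decomposition of `perm_m` uses at least
`C(m, s)` products», files `Theorems/RigidityForcesSymmetryRankRigidMinimalReprStubLevelBound*.lean`), kept out of
the proof files because new definitions do not belong in proof files: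

* `graphMonomialOn I τ = ∑_{i ∈ I} e_{(i, τ i)}` — the part of the graph monomial `graphMonomial τ` of a self-map
  `τ` of `[m]` (one variable `X_{i, τ i}` per row `i`, `Literature…GlynnMultilinearSigmaPiSigma`) lying in the rows
  `I`; with its pointwise formula, `graphMonomialOn I τ + graphMonomialOn Iᶜ τ = graphMonomial τ`, dependence on
  `τ|_I` only, and its column counts;
* `tau σ a b = σ[p ↦ a, q ↦ b]` for `σ ∈ 𝔖_{n+2}`, `p = σ⁻¹ 0`, `q = σ⁻¹ 1` — the self-map agreeing with `σ` off
  `{p, q}` and sending `p ↦ a`, `q ↦ b`.  For `a, b ∈ {0, 1}` (the two TIED columns of the rung) the four graph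
  monomials of `tau σ a b` form the `2 × 2` BLOCK of `σ`; the permanent's coefficients on the block are
  `[[0, 1], [1, 0]]` (`coeff_tau_zero_one_perPoly`, `coeff_tau_one_zero_perPoly`, `coeff_tau_self_perPoly`, from the
  tree's `coeff_graphMonomial_perPoly`), and for tied `a, b` the map `tau σ a b` hits an untied column `j` exactly
  where `σ` does (`tau_eq_iff_of_untied`) and hits the tied columns exactly on `{p, q}` (`tau_val_le_one_iff`).

Conventions: a variable `(i, j) : Fin m × Fin m` has ROW `i` and COLUMN `j`; `perPoly (Fin m) ℂ` is the tree's
generic permanent; the block is indexed by `Fin (n + 2)` so that the tied columns are the numerals `0, 1`.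
HONEST FRAMING: definitions and elementary identities only; nothing of the crux or of `VP ≠ VNP` is asserted.
-/

set_option autoImplicit false

-- the mandated summit-side namespace repeats a component by design (single-problem summit)
set_option linter.dupNamespace false

open MvPolynomial Finset
open Literature.Computability.AlgebraicComplexity

namespace Summit.ValiantsHypothesis.ValiantsHypothesis.Theorems.RigidityForcesSymmetryRankRigidMinimalRepr

noncomputable section

/-! ### Graph monomials restricted to a set of rows -/

variable {m : ℕ}

/-- The exponent vector `∑_{i ∈ I} e_{(i, τ i)}` of the monomial `∏_{i ∈ I} X_{i, τ i}`: the part of the graph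
monomial of `τ` (`graphMonomial τ`, one variable per row) lying in the rows `I`. [folklore] -/
def graphMonomialOn (I : Finset (Fin m)) (τ : Fin m → Fin m) : (Fin m × Fin m) →₀ ℕ :=
  ∑ i ∈ I, Finsupp.single (i, τ i) 1

/-- `graphMonomialOn I τ (i, j) = [i ∈ I ∧ τ i = j]`. [folklore] -/
theorem graphMonomialOn_apply (I : Finset (Fin m)) (τ : Fin m → Fin m) (i j : Fin m) :
    graphMonomialOn I τ (i, j) = if i ∈ I ∧ τ i = j then 1 else 0 := by
  classical
  simp only [graphMonomialOn, Finsupp.coe_finsetSum, Finset.sum_apply, Finsupp.single_apply,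
    Prod.mk.injEq]
  by_cases hi : i ∈ I
  · rw [Finset.sum_eq_single i]
    · simp [hi]
    · intro i' _ hi'
      simp [hi']
    · intro h
      exact absurd hi h
  · rw [Finset.sum_eq_zero]
    · simp [hi]
    · intro i' hi'
      have : i' ≠ i := fun h => hi (h ▸ hi')
      simp [this]

/-- The row parts over `I` and `Iᶜ` add up to the graph monomial. [folklore] -/
theorem graphMonomialOn_add_compl (I : Finset (Fin m)) (τ : Fin m → Fin m) :
    graphMonomialOn I τ + graphMonomialOn Iᶜ τ = graphMonomial τ := by
  ext ⟨i, j⟩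
  rw [Finsupp.add_apply, graphMonomialOn_apply, graphMonomialOn_apply, graphMonomial_apply]
  by_cases hi : i ∈ I <;> by_cases hij : τ i = j <;> simp [hi, hij]

/-- The row part over `I` only depends on the values of `τ` on `I`. [folklore] -/
theorem graphMonomialOn_congr {I : Finset (Fin m)} {τ τ' : Fin m → Fin m} (h : ∀ i ∈ I, τ i = τ' i) :
    graphMonomialOn I τ = graphMonomialOn I τ' := by
  unfold graphMonomialOn
  exact Finset.sum_congr rfl fun i hi => by rw [h i hi]

/-- Column count of a row part: `∑_i graphMonomialOn I τ (i, j) = #{i ∈ I | τ i = j}`. [folklore] -/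
theorem sum_graphMonomialOn_col (I : Finset (Fin m)) (τ : Fin m → Fin m) (j : Fin m) :
    (∑ i : Fin m, graphMonomialOn I τ (i, j)) = (I.filter fun i => τ i = j).card := by
  classical
  simp_rw [graphMonomialOn_apply]
  rw [Finset.sum_boole]
  exact congrArg Finset.card (by ext i; simp [Finset.mem_filter])


/-! ### The `2 × 2` block of a permutation: `σ[p ↦ a, q ↦ b]` for `p = σ⁻¹ 0`, `q = σ⁻¹ 1` -/

variable {n : ℕ}

/-- For `σ ∈ 𝔖_{n+2}` with `p = σ⁻¹ 0`, `q = σ⁻¹ 1` and columns `a, b`: the self-map `σ[p ↦ a, q ↦ b]` of `[n+2]`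
(agreeing with `σ` off `{p, q}`).  For `a, b ∈ {0, 1}` its graph monomials `x_{p a} x_{q b} ∏_{r ≠ p, q} x_{r σ r}`
are the four monomials of the `2 × 2` block of `σ` (the two tied columns `0, 1` distributed over the two rows
`p, q`). [folklore] -/
def tau (σ : Equiv.Perm (Fin (n + 2))) (a b : Fin (n + 2)) : Fin (n + 2) → Fin (n + 2) :=
  fun r => if r = σ.symm 0 then a else if r = σ.symm 1 then b else σ r

/-- `σ⁻¹ 0 ≠ σ⁻¹ 1`. [folklore] -/
theorem symm_zero_ne_symm_one (σ : Equiv.Perm (Fin (n + 2))) : σ.symm 0 ≠ σ.symm 1 := by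
  intro h
  have := σ.symm.injective h
  exact absurd (congrArg Fin.val this) (by simp)

/-- Value of `σ[p ↦ a, q ↦ b]` at `p`. [folklore] -/
theorem tau_apply_symm_zero (σ : Equiv.Perm (Fin (n + 2))) (a b : Fin (n + 2)) :
    tau σ a b (σ.symm 0) = a := by
  simp [tau]

/-- Value of `σ[p ↦ a, q ↦ b]` at `q`. [folklore] -/
theorem tau_apply_symm_one (σ : Equiv.Perm (Fin (n + 2))) (a b : Fin (n + 2)) :
    tau σ a b (σ.symm 1) = b := by
  simp [tau, (symm_zero_ne_symm_one σ).symm]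

/-- Value of `σ[p ↦ a, q ↦ b]` off `{p, q}`. [folklore] -/
theorem tau_apply_of_ne (σ : Equiv.Perm (Fin (n + 2))) (a b : Fin (n + 2)) {r : Fin (n + 2)}
    (h0 : r ≠ σ.symm 0) (h1 : r ≠ σ.symm 1) : tau σ a b r = σ r := by
  simp [tau, h0, h1]

/-- `σ[p ↦ 0, q ↦ 1] = σ`. [folklore] -/
theorem tau_zero_one (σ : Equiv.Perm (Fin (n + 2))) : tau σ 0 1 = ⇑σ := by
  funext r
  by_cases h0 : r = σ.symm 0
  · rw [h0, tau_apply_symm_zero, Equiv.apply_symm_apply]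
  by_cases h1 : r = σ.symm 1
  · rw [h1, tau_apply_symm_one, Equiv.apply_symm_apply]
  rw [tau_apply_of_ne σ 0 1 h0 h1]

/-- `σ[p ↦ 1, q ↦ 0] = (0 1) ∘ σ`. [folklore] -/
theorem tau_one_zero (σ : Equiv.Perm (Fin (n + 2))) : tau σ 1 0 = ⇑(σ.trans (Equiv.swap 0 1)) := by
  funext r
  rw [Equiv.trans_apply]
  by_cases h0 : r = σ.symm 0
  · rw [h0, tau_apply_symm_zero, Equiv.apply_symm_apply, Equiv.swap_apply_left]
  by_cases h1 : r = σ.symm 1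
  · rw [h1, tau_apply_symm_one, Equiv.apply_symm_apply, Equiv.swap_apply_right]
  rw [tau_apply_of_ne σ 1 0 h0 h1, Equiv.swap_apply_of_ne_of_ne]
  · intro h
    exact h0 (by rw [← h, Equiv.symm_apply_apply])
  · intro h
    exact h1 (by rw [← h, Equiv.symm_apply_apply])

/-- `σ[p ↦ a, q ↦ a]` is not injective. [folklore] -/
theorem not_injective_tau_self (σ : Equiv.Perm (Fin (n + 2))) (a : Fin (n + 2)) :
    ¬ Function.Injective (tau σ a a) := by
  intro h
  apply symm_zero_ne_symm_one σ
  apply h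
  rw [tau_apply_symm_zero, tau_apply_symm_one]

/-- The permanent on the block, off-diagonal entry `(0, 1)`: coefficient `1`. [folklore] -/
theorem coeff_tau_zero_one_perPoly (σ : Equiv.Perm (Fin (n + 2))) :
    coeff (graphMonomial (tau σ 0 1)) (perPoly (Fin (n + 2)) ℂ) = 1 := by
  rw [coeff_graphMonomial_perPoly, tau_zero_one, if_pos σ.bijective]

/-- The permanent on the block, off-diagonal entry `(1, 0)`: coefficient `1`. [folklore] -/
theorem coeff_tau_one_zero_perPoly (σ : Equiv.Perm (Fin (n + 2))) :
    coeff (graphMonomial (tau σ 1 0)) (perPoly (Fin (n + 2)) ℂ) = 1 := by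
  rw [coeff_graphMonomial_perPoly, tau_one_zero, if_pos (Equiv.bijective _)]

/-- The permanent on the block, diagonal entries: coefficient `0` (a tied column used twice). [folklore] -/
theorem coeff_tau_self_perPoly (σ : Equiv.Perm (Fin (n + 2))) (a : Fin (n + 2)) :
    coeff (graphMonomial (tau σ a a)) (perPoly (Fin (n + 2)) ℂ) = 0 := by
  rw [coeff_graphMonomial_perPoly, if_neg (fun h => not_injective_tau_self σ a h.1)]

/-- For `a, b` tied (`≤ 1`) and `j` untied (`1 < j`): `σ[p ↦ a, q ↦ b] i = j ↔ σ i = j`. [folklore] -/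
theorem tau_eq_iff_of_untied (σ : Equiv.Perm (Fin (n + 2))) {a b j : Fin (n + 2)} (ha : a.val ≤ 1)
    (hb : b.val ≤ 1) (hj : 1 < j.val) (i : Fin (n + 2)) : tau σ a b i = j ↔ σ i = j := by
  by_cases h0 : i = σ.symm 0
  · rw [h0, tau_apply_symm_zero, Equiv.apply_symm_apply]
    constructor
    · intro h; exact absurd (congrArg Fin.val h) (by omega)
    · intro h; exact absurd (congrArg Fin.val h) (by simp; omega)
  by_cases h1 : i = σ.symm 1
  · rw [h1, tau_apply_symm_one, Equiv.apply_symm_apply]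
    constructor
    · intro h; exact absurd (congrArg Fin.val h) (by omega)
    · intro h; exact absurd (congrArg Fin.val h) (by simp; omega)
  rw [tau_apply_of_ne σ a b h0 h1]

/-- For `a, b` tied: `σ[p ↦ a, q ↦ b] i` is tied iff `i ∈ {p, q}`. [folklore] -/
theorem tau_val_le_one_iff (σ : Equiv.Perm (Fin (n + 2))) {a b : Fin (n + 2)} (ha : a.val ≤ 1)
    (hb : b.val ≤ 1) (i : Fin (n + 2)) : (tau σ a b i).val ≤ 1 ↔ i = σ.symm 0 ∨ i = σ.symm 1 := by
  by_cases h0 : i = σ.symm 0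
  · rw [h0, tau_apply_symm_zero]; exact ⟨fun _ => Or.inl rfl, fun _ => ha⟩
  by_cases h1 : i = σ.symm 1
  · rw [h1, tau_apply_symm_one]; exact ⟨fun _ => Or.inr rfl, fun _ => hb⟩
  rw [tau_apply_of_ne σ a b h0 h1]
  constructor
  · intro h
    exfalso
    -- `σ i ≤ 1` forces `σ i ∈ {0, 1}`, i.e. `i ∈ {p, q}`
    have : σ i = 0 ∨ σ i = 1 := by
      rcases Nat.le_one_iff_eq_zero_or_eq_one.1 h with h' | h'
      · exact Or.inl (Fin.ext h')
      · exact Or.inr (Fin.ext h')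
    rcases this with h' | h'
    · exact h0 (by rw [← h', Equiv.symm_apply_apply])
    · exact h1 (by rw [← h', Equiv.symm_apply_apply])
  · rintro (h | h)
    · exact absurd h h0
    · exact absurd h h1


end

end Summit.ValiantsHypothesis.ValiantsHypothesis.Theorems.RigidityForcesSymmetryRankRigidMinimalRepr
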